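import Literature.Algebra.Homology.OrderedCechShuffleCoefficient
import HarnessLib

/-!
# Shuffle coefficients: the last-vertex recursion of the two sides of the cochain-map identity
# (Eilenberg–Mac Lane 1953 §5; The Stacks Project, Tag 0BEC)

Layer `Literature/Algebra/Homology` (proved lemmas only; 0 `def`, 0 named facts, no instance, no notation).  Sequel of
`Algebra/Homology/OrderedCechShuffleCoefficient` (the coefficient function `m(s,t,T) = shuffleCoeff s t T` of the Eilenberg–Zilber map on the
ordered Čech complex of a product cover, its support, the face-sign lemmas).  This file isolates the two recursions through the last
vertex `w₁ = (max s, max t)` that drive the induction of `Algebra/Homology/OrderedCechShuffleCoefficientIdentity`: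

* §4 **`sum_shuffleCoeff_insert_of_max_mem`** — for `w₁ ∈ R` (not the `1 × 1` rectangle), the LEFT side
  `Σ_{w ∉ R} m(s,t,R ∪ w) ε(R ∪ w, w)` equals `(-1)^{#t-1}` times the same sum for `(s ∖ max s, t, R ∖ w₁)` plus the same sum for
  `(s, t ∖ max t, R ∖ w₁)`;
* §5 the RIGHT-side terms: `m(s ∖ i, t, R)` vanishes for `i ≠ max s` when `w₁ ∉ R` (`…_eq_zero_of_max_not_mem`) and unfolds through `w₁`
  when `w₁ ∈ R ≠ {w₁}` (`shuffleCoeff_erase_left_unfold` / `…_right_unfold`).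

Cell `hodgecm-mathlib` (D-0151), F-11 / J3 Künneth packet, brick (K2-c-1) of F0P1b-p04.  HC_CM is proved only modulo the 7 printed citations until
rung 0 closes — nothing here bears on a summit statement.

## References
* S. Eilenberg, S. Mac Lane, *On the groups `H(Π,n)`, I*, Ann. of Math. 58 (1953), §5 (the shuffle map `∇`, Thm. 5.2). [EilenbergMacLane1953]
* The Stacks Project, Tag 0BEC (Künneth formula via the double Čech complex). [StacksProject]
* U. Görtz, T. Wedhorn, *Algebraic Geometry II* (2023), Def. 21.68 (p. 180) (the Čech face signs). [GortzWedhorn2023]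
-/

open Finset

namespace Literature.Algebra.Homology

namespace OrderedCech

variable {ι κ : Type} [LinearOrder ι] [LinearOrder κ]

omit [LinearOrder κ] in
/-- Erasing a non-maximal element does not change the maximum. [folklore] -/
private theorem max'_erase_eq_max' {s : Finset ι} (hs : s.Nonempty) {i : ι} (hi : i ≠ s.max' hs) (h' : (s.erase i).Nonempty) :
    (s.erase i).max' h' = s.max' hs := by
  refine le_antisymm (Finset.max'_le _ _ _ fun x hx => s.le_max' x (Finset.mem_of_mem_erase hx)) ?_
  exact Finset.le_max' _ _ (Finset.mem_erase.mpr ⟨hi.symm, s.max'_mem hs⟩)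


/-! ### §4 The last-vertex recursion of the left-hand side -/

/-- **Recursion of the left-hand side through the last vertex.**  If `w₁ = (max s, max t) ∈ R` and `s × t` is not `1 × 1`, then with
`R' = R ∖ w₁`: `Σ_{w ∉ R} m(s,t,R ∪ w) ε(R ∪ w, w) = (-1)^{#t-1} Σ_{w ∉ R'} m(s ∖ max s, t, R' ∪ w) ε(R' ∪ w, w) + Σ_{w ∉ R'} m(s, t ∖ max t, R' ∪ w) ε(R' ∪ w, w)`
(the sums over the respective rectangles). [cite: EilenbergMacLane1953, §5 (proof of Thm. 5.2)] -/
theorem sum_shuffleCoeff_insert_of_max_mem {s : Finset ι} {t : Finset κ} (hs : s.Nonempty) (ht : t.Nonempty)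
    (h1 : ¬ (s.card = 1 ∧ t.card = 1)) {R : Finset (ι ×ₗ κ)} (hw₁ : toLex (s.max' hs, t.max' ht) ∈ R) :
    ∑ w ∈ (s ×ˢ t).image toLex \ R, shuffleCoeff s t (insert w R) * sign ℤ (insert w R) w =
      (-1) ^ (t.card - 1) * ∑ w ∈ ((s.erase (s.max' hs)) ×ˢ t).image toLex \ R.erase (toLex (s.max' hs, t.max' ht)),
          shuffleCoeff (s.erase (s.max' hs)) t (insert w (R.erase (toLex (s.max' hs, t.max' ht)))) *
            sign ℤ (insert w (R.erase (toLex (s.max' hs, t.max' ht)))) w +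
        ∑ w ∈ (s ×ˢ (t.erase (t.max' ht))).image toLex \ R.erase (toLex (s.max' hs, t.max' ht)),
          shuffleCoeff s (t.erase (t.max' ht)) (insert w (R.erase (toLex (s.max' hs, t.max' ht)))) *
            sign ℤ (insert w (R.erase (toLex (s.max' hs, t.max' ht)))) w := by
  set w₁ : ι ×ₗ κ := toLex (s.max' hs, t.max' ht) with hw₁def
  set R' := R.erase w₁ with hR'
  set S := (s ×ˢ t).image toLex \ R with hS
  -- (1) unfold every term over `S`
  have hstep : ∀ w ∈ S, shuffleCoeff s t (insert w R) * sign ℤ (insert w R) w =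
      (-1) ^ (t.card - 1) * (shuffleCoeff (s.erase (s.max' hs)) t (insert w R') * sign ℤ (insert w R') w) +
        shuffleCoeff s (t.erase (t.max' ht)) (insert w R') * sign ℤ (insert w R') w := by
    intro w hw
    rw [hS, Finset.mem_sdiff] at hw
    have hne : w ≠ w₁ := fun h => hw.2 (h ▸ hw₁)
    have hle : w ≤ w₁ := le_max_of_mem_image_toLex hs ht hw.1
    have hins : insert w R = insert w₁ (insert w R') := by
      rw [hR', Finset.insert_comm, Finset.insert_erase hw₁]
    have hsign : sign ℤ (insert w R) w = sign ℤ (insert w R') w := by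
      rw [hins, sign_insert_of_not_lt (fun h => (lt_irrefl _) (lt_of_le_of_lt hle h))]
    have herase : (insert w R).erase w₁ = insert w R' := by
      rw [hR', Finset.erase_insert_of_ne hne]
    rw [shuffleCoeff_unfold hs ht (Finset.mem_insert_of_mem hw₁), herase, if_neg (fun h => h1 ⟨h.1, h.2.1⟩), add_zero,
      hsign]
    ring
  rw [Finset.sum_congr rfl hstep, Finset.sum_add_distrib, ← Finset.mul_sum]
  -- (2) shrink the index sets: terms outside the smaller rectangles vanish
  have hsub₁ : ((s.erase (s.max' hs)) ×ˢ t).image toLex \ R' ⊆ S := by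
    intro w hw
    rw [Finset.mem_sdiff, mem_image_toLex] at hw
    rw [hS, Finset.mem_sdiff, mem_image_toLex]
    refine ⟨⟨Finset.mem_of_mem_erase hw.1.1, hw.1.2⟩, fun hwR => hw.2 ?_⟩
    rw [hR', Finset.mem_erase]
    refine ⟨fun h => ?_, hwR⟩
    have := hw.1.1
    rw [h] at this
    exact Finset.notMem_erase _ _ this
  have hsub₂ : (s ×ˢ (t.erase (t.max' ht))).image toLex \ R' ⊆ S := by
    intro w hw
    rw [Finset.mem_sdiff, mem_image_toLex] at hw
    rw [hS, Finset.mem_sdiff, mem_image_toLex]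
    refine ⟨⟨hw.1.1, Finset.mem_of_mem_erase hw.1.2⟩, fun hwR => hw.2 ?_⟩
    rw [hR', Finset.mem_erase]
    refine ⟨fun h => ?_, hwR⟩
    have := hw.1.2
    rw [h] at this
    exact Finset.notMem_erase _ _ this
  have hvan₁ : ∀ w ∈ S, w ∉ ((s.erase (s.max' hs)) ×ˢ t).image toLex \ R' →
      shuffleCoeff (s.erase (s.max' hs)) t (insert w R') * sign ℤ (insert w R') w = 0 := by
    intro w hw hw'
    rw [hS, Finset.mem_sdiff, mem_image_toLex] at hw
    have hwR' : w ∉ R' := fun h => hw.2 (Finset.mem_of_mem_erase h)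
    have h1w : (ofLex w).1 = s.max' hs := by
      by_contra hne
      exact hw' (Finset.mem_sdiff.mpr ⟨mem_image_toLex.mpr ⟨Finset.mem_erase.mpr ⟨hne, hw.1.1⟩, hw.1.2⟩, hwR'⟩)
    rw [shuffleCoeff_erase_left_eq_zero_of_mem (Finset.mem_insert_self w R') h1w, zero_mul]
  have hvan₂ : ∀ w ∈ S, w ∉ (s ×ˢ (t.erase (t.max' ht))).image toLex \ R' →
      shuffleCoeff s (t.erase (t.max' ht)) (insert w R') * sign ℤ (insert w R') w = 0 := by
    intro w hw hw'
    rw [hS, Finset.mem_sdiff, mem_image_toLex] at hw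
    have hwR' : w ∉ R' := fun h => hw.2 (Finset.mem_of_mem_erase h)
    have h2w : (ofLex w).2 = t.max' ht := by
      by_contra hne
      exact hw' (Finset.mem_sdiff.mpr ⟨mem_image_toLex.mpr ⟨hw.1.1, Finset.mem_erase.mpr ⟨hne, hw.1.2⟩⟩, hwR'⟩)
    rw [shuffleCoeff_erase_right_eq_zero_of_mem (Finset.mem_insert_self w R') h2w, zero_mul]
  rw [← Finset.sum_subset hsub₁ hvan₁, ← Finset.sum_subset hsub₂ hvan₂]

/-! ### §5 Vanishing and unfolding of the right-hand side terms -/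

/-- If the last vertex is NOT in `R`, then `m(s ∖ i, t, R) = 0` for every `i ≠ max s` (the rectangle `(s ∖ i) × t` has the same last
vertex). [cite: EilenbergMacLane1953, §5] -/
theorem shuffleCoeff_erase_left_eq_zero_of_max_not_mem {s : Finset ι} {t : Finset κ} (hs : s.Nonempty) (ht : t.Nonempty)
    {R : Finset (ι ×ₗ κ)} (hw₁ : toLex (s.max' hs, t.max' ht) ∉ R) {i : ι} (hi : i ≠ s.max' hs) :
    shuffleCoeff (s.erase i) t R = 0 := by
  by_cases h' : (s.erase i).Nonempty
  · refine shuffleCoeff_eq_zero_of_max_not_mem h' ht ?_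
    rwa [max'_erase_eq_max' hs hi h']
  · exact shuffleCoeff_of_not_nonempty_left h' t R

/-- If the last vertex is NOT in `R`, then `m(s, t ∖ j, R) = 0` for every `j ≠ max t`. [cite: EilenbergMacLane1953, §5] -/
theorem shuffleCoeff_erase_right_eq_zero_of_max_not_mem {s : Finset ι} {t : Finset κ} (hs : s.Nonempty) (ht : t.Nonempty)
    {R : Finset (ι ×ₗ κ)} (hw₁ : toLex (s.max' hs, t.max' ht) ∉ R) {j : κ} (hj : j ≠ t.max' ht) :
    shuffleCoeff s (t.erase j) R = 0 := by
  by_cases h' : (t.erase j).Nonempty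
  · refine shuffleCoeff_eq_zero_of_max_not_mem hs h' ?_
    rwa [max'_erase_eq_max' ht hj h']
  · exact shuffleCoeff_of_not_nonempty_right s h' R

/-- Unfolding `m(s ∖ i, t, R)` for `i ≠ max s` when the last vertex lies in `R` (no `1 × 1` correction when `R ≠ {w₁}`).
[cite: EilenbergMacLane1953, §5] -/
theorem shuffleCoeff_erase_left_unfold {s : Finset ι} {t : Finset κ} (hs : s.Nonempty) (ht : t.Nonempty)
    {R : Finset (ι ×ₗ κ)} (hw₁ : toLex (s.max' hs, t.max' ht) ∈ R) (hR : R ≠ {toLex (s.max' hs, t.max' ht)})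
    {i : ι} (hi : i ≠ s.max' hs) :
    shuffleCoeff (s.erase i) t R =
      (-1) ^ (t.card - 1) * shuffleCoeff ((s.erase i).erase (s.max' hs)) t (R.erase (toLex (s.max' hs, t.max' ht))) +
        shuffleCoeff (s.erase i) (t.erase (t.max' ht)) (R.erase (toLex (s.max' hs, t.max' ht))) := by
  by_cases h' : (s.erase i).Nonempty
  · have hmax := max'_erase_eq_max' hs hi h'
    have hw' : toLex ((s.erase i).max' h', t.max' ht) ∈ R := by rwa [hmax]
    rw [shuffleCoeff_unfold h' ht hw', hmax, if_neg (fun h => hR h.2.2), add_zero]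
  · rw [Finset.not_nonempty_iff_eq_empty] at h'
    rw [h', Finset.erase_empty, shuffleCoeff_of_not_nonempty_left Finset.not_nonempty_empty,
      shuffleCoeff_of_not_nonempty_left Finset.not_nonempty_empty,
      shuffleCoeff_of_not_nonempty_left Finset.not_nonempty_empty, mul_zero, add_zero]

/-- Unfolding `m(s, t ∖ j, R)` for `j ≠ max t` when the last vertex lies in `R` (and `R ≠ {w₁}`). [cite: EilenbergMacLane1953, §5] -/
theorem shuffleCoeff_erase_right_unfold {s : Finset ι} {t : Finset κ} (hs : s.Nonempty) (ht : t.Nonempty)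
    {R : Finset (ι ×ₗ κ)} (hw₁ : toLex (s.max' hs, t.max' ht) ∈ R) (hR : R ≠ {toLex (s.max' hs, t.max' ht)})
    {j : κ} (hj : j ≠ t.max' ht) :
    shuffleCoeff s (t.erase j) R =
      (-1) ^ ((t.erase j).card - 1) * shuffleCoeff (s.erase (s.max' hs)) (t.erase j) (R.erase (toLex (s.max' hs, t.max' ht))) +
        shuffleCoeff s ((t.erase j).erase (t.max' ht)) (R.erase (toLex (s.max' hs, t.max' ht))) := by
  by_cases h' : (t.erase j).Nonempty
  · have hmax := max'_erase_eq_max' ht hj h'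
    have hw' : toLex (s.max' hs, (t.erase j).max' h') ∈ R := by rwa [hmax]
    rw [shuffleCoeff_unfold hs h' hw', hmax, if_neg (fun h => hR h.2.2), add_zero]
  · rw [Finset.not_nonempty_iff_eq_empty] at h'
    rw [h', Finset.erase_empty, shuffleCoeff_of_not_nonempty_right _ Finset.not_nonempty_empty,
      shuffleCoeff_of_not_nonempty_right _ Finset.not_nonempty_empty,
      shuffleCoeff_of_not_nonempty_right _ Finset.not_nonempty_empty, mul_zero, add_zero]


end OrderedCech

end Literature.Algebra.Homology
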